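import Mathlib
import Summits.RiemannHypothesis.RiemannHypothesis.Theorems.WeilFarFloorCoshCouplingRH
import Literature.NumberTheory.LFunctions.CramerMeanSquareRH
import Literature.NumberTheory.LFunctions.MertensFirstVonMangoldtUpper
import HarnessLib

/-!
# Under RH the cosh profile is an approximate eigenvector of the prime-shift operator with coupling `O(√b)·√P` (Cramér)

Helper file (`--supports stmt-RiemannHypothesis-0098`, lead-track anchor: Weil-positivity window ladder, format-C far bound),
pure proofs.  Seat rh-explicit-weil-1 gen14 (memo `run/shared/lean/pub/rh-explicit/rh-explicit-weil-1/FORMAT-K3.md` §14.10 / §15):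
stage 1′ of the SHARP rate for C-XIII″.

Stage 1 (`WeilFarFloorCoshCouplingRH`) bounded the deviation `T_bC_b − (e^b + b)C_b` of the cosh profile
`C_b = cosh(·/2)·1_{[−b,b]}` under the prime-shift operator POINTWISE by von Koch (`ψ(y) − y = O(√y log²y)`), giving
`∫_{(−b,b)} (T_bC_b − (e^b + b)C_b)² ≤ K b⁵ (b + sinh b)`.  Two things are lossy there: (i) the RH-free piece `x sinh(x/2)` of
the deviation (`primeShiftOp_coshProfile_sub_eq`) has ‖·‖² ≍ b²·P but is almost parallel to `C_b` — re-centring the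
approximate eigenvalue at `λ_b = e^b + 2b − 1` leaves `x sinh(x/2) − (b − 1)cosh(x/2)`, whose square integrates to `≤ e^b`
(exact antiderivatives `e^x((x−b)²+1)`, `−e^{−x}((x+b)²+1)`); (ii) the prime-counting errors `ψ(e^{b∓x}) − e^{b∓x}` enter
through `∫ e^{±x}(ψ(e^{b∓x}) − e^{b∓x})² dx = e^b ∫_0^{2b} e^{−v}(ψ(e^v) − e^v)² dv`, which is CRAMÉR'S MEAN SQUARE in the
logarithmic variable (Literature `CramerMeanSquare.integral_exp_neg_mul_sq_psi_exp_sub_le_of_RH`, Montgomery–Vaughan Thm. 13.5: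
`≤ K(2b + 1)` under RH) instead of von Koch's pointwise `b⁴e^b`.  Result (`integral_primeShiftOp_coshProfile_sub_sharp_sq_le_of_RH`):

  **RH → ∃ K ∀ b ≥ 1: `∫_{(−b,b)} ((T_bC_b)(x) − (e^b + 2b − 1)C_b(x))² dx ≤ K·(b + 1)·(b + sinh b)`**,

i.e. the coupling `‖P^⊥T_bC_b‖²/‖C_b‖²` is `O(b)` — the order MEASURED for the floor gap (`gap(a)·e^a/a ≈ 0.4`, FORMAT-K3 §14.7)
and the input that turns the kernel rate `λ_max(a) − R_c(a) = O(a⁵e^{−a})` of `WeilFarFloorCoshOptimalRateRH` into `O(a·e^{−a})`.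
Standard axioms only; RH enters as Mathlib's `RiemannHypothesis`.
-/

set_option linter.dupNamespace false
set_option autoImplicit false

noncomputable section

open MeasureTheory Set Filter
open scoped Real Topology ArithmeticFunction.vonMangoldt Chebyshev

namespace Summit.RiemannHypothesis.RiemannHypothesis.Theorems.WeilFormatC

namespace FloorCoshSplit

open Literature.NumberTheory.LFunctions FloorCosh

/-! ## §1 Elementary integrals on `[−b, b]` -/

/-- `∫_{−b}^{b} e^x dx ≤ e^b` and `∫_{−b}^{b} e^{−x} dx ≤ e^b`. -/
theorem integral_exp_le_and (b : ℝ) :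
    (∫ x in (-b)..b, Real.exp x) ≤ Real.exp b ∧ (∫ x in (-b)..b, Real.exp (-x)) ≤ Real.exp b := by
  constructor
  · rw [integral_exp]; linarith [Real.exp_pos (-b)]
  · have h := intervalIntegral.integral_comp_neg (a := -b) (b := b) (fun x ↦ Real.exp x)
    simp only [neg_neg] at h
    rw [h, integral_exp]; linarith [Real.exp_pos (-b)]

/-- The re-centred RH-free piece: `∫_{−b}^{b} e^{x}(x − b + 1)² dx ≤ e^b` (antiderivative `e^x((x − b)² + 1)`). -/
theorem integral_exp_mul_sq_sub_le (b : ℝ) :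
    ∫ x in (-b)..b, Real.exp x * (x - b + 1) ^ 2 ≤ Real.exp b := by
  have hderiv : ∀ x ∈ uIcc (-b) b, HasDerivAt (fun x ↦ Real.exp x * ((x - b) ^ 2 + 1))
      (Real.exp x * (x - b + 1) ^ 2) x := by
    intro x _
    have h1 : HasDerivAt (fun x ↦ (x - b) ^ 2 + 1) (2 * (x - b)) x := by
      have := ((hasDerivAt_id x).sub_const b).pow 2
      simpa using this.add_const 1
    have h := (Real.hasDerivAt_exp x).mul h1
    convert h using 1 <;> first | rfl | ring
  rw [intervalIntegral.integral_eq_sub_of_hasDerivAt hderiv ((by fun_prop : Continuous fun x ↦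
    Real.exp x * (x - b + 1) ^ 2).intervalIntegrable _ _)]
  have : 0 ≤ Real.exp (-b) * ((-b - b) ^ 2 + 1) := by positivity
  simp only [sub_self]
  nlinarith [this, Real.exp_pos b]

/-- The mirrored piece: `∫_{−b}^{b} e^{−x}(x + b − 1)² dx ≤ e^b` (antiderivative `−e^{−x}((x + b)² + 1)`). -/
theorem integral_exp_neg_mul_sq_add_le (b : ℝ) :
    ∫ x in (-b)..b, Real.exp (-x) * (x + b - 1) ^ 2 ≤ Real.exp b := by
  have h := intervalIntegral.integral_comp_neg (a := -b) (b := b) (fun x ↦ Real.exp x * (x - b + 1) ^ 2)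
  simp only [neg_neg] at h
  have e : (fun x ↦ Real.exp (-x) * (x + b - 1) ^ 2) = fun x ↦ Real.exp (-x) * (-x - b + 1) ^ 2 := by
    funext x; ring
  rw [e, h]
  exact integral_exp_mul_sq_sub_le b

/-- Pointwise: `(x sinh(x/2) − (b−1)cosh(x/2))² ≤ (e^x (x−b+1)² + e^{−x}(x+b−1)²)/2`. -/
theorem sq_recentred_le (b x : ℝ) :
    (x * Real.sinh (x / 2) - (b - 1) * Real.cosh (x / 2)) ^ 2
      ≤ (Real.exp x * (x - b + 1) ^ 2 + Real.exp (-x) * (x + b - 1) ^ 2) / 2 := by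
  rw [Real.sinh_eq, Real.cosh_eq]
  have hex1 : Real.exp (x / 2) ^ 2 = Real.exp x := by rw [← Real.exp_nat_mul]; ring_nf
  have hex2 : Real.exp (-(x / 2)) ^ 2 = Real.exp (-x) := by rw [← Real.exp_nat_mul]; ring_nf
  have e : x * ((Real.exp (x / 2) - Real.exp (-(x / 2))) / 2) - (b - 1) * ((Real.exp (x / 2) + Real.exp (-(x / 2))) / 2)
      = (Real.exp (x / 2) * (x - b + 1) - Real.exp (-(x / 2)) * (x + b - 1)) / 2 := by ring
  rw [e]
  nlinarith [sq_nonneg (Real.exp (x / 2) * (x - b + 1) + Real.exp (-(x / 2)) * (x + b - 1)), hex1, hex2]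

/-! ## §2 Bounded measurable functions are interval integrable; the prime-error pieces -/

/-- A measurable function bounded on `[a, c]` is interval integrable there. -/
theorem intervalIntegrable_of_abs_le {f : ℝ → ℝ} {a c M : ℝ} (hac : a ≤ c) (hf : Measurable f)
    (hM : ∀ x ∈ Icc a c, |f x| ≤ M) : IntervalIntegrable f volume a c := by
  rw [intervalIntegrable_iff_integrableOn_Ioc_of_le hac]
  refine Measure.integrableOn_of_bounded (M := M) (by simp) hf.aestronglyMeasurable ?_
  exact (ae_restrict_iff' measurableSet_Ioc).2 (Eventually.of_forall fun x hx ↦ by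
    rw [Real.norm_eq_abs]; exact hM x ⟨hx.1.le, hx.2⟩)

/-- The Cramér piece: under RH, `∫_{−b}^{b} e^{x}(ψ(e^{b−x}) − e^{b−x})² dx ≤ K(2b+1)e^b` and the mirrored
`∫_{−b}^{b} e^{−x}(ψ(e^{b+x}) − e^{b+x})² dx ≤ K(2b+1)e^b`, `K` the constant of
`CramerMeanSquare.integral_exp_neg_mul_sq_psi_exp_sub_le_of_RH` (substitutions `v = b ∓ x`). -/
theorem integral_exp_mul_sq_psi_sub_le_of_RH (hRH : RiemannHypothesis) :
    ∃ K : ℝ, 0 ≤ K ∧ ∀ b : ℝ, 0 ≤ b →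
      (∫ x in (-b)..b, Real.exp x * (ψ (Real.exp (b - x)) - Real.exp (b - x)) ^ 2) ≤ K * (2 * b + 1) * Real.exp b ∧
      (∫ x in (-b)..b, Real.exp (-x) * (ψ (Real.exp (b + x)) - Real.exp (b + x)) ^ 2) ≤ K * (2 * b + 1) * Real.exp b := by
  obtain ⟨K, hK⟩ := CramerMeanSquare.integral_exp_neg_mul_sq_psi_exp_sub_le_of_RH hRH
  have hK0 : 0 ≤ K := by
    have h := hK 0 le_rfl
    simp at h
    exact h
  refine ⟨K, hK0, fun b hb ↦ ?_⟩
  have hmain : ∫ v in (0 : ℝ)..(2 * b), Real.exp (b - v) * (ψ (Real.exp v) - Real.exp v) ^ 2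
      ≤ K * (2 * b + 1) * Real.exp b := by
    have e : (fun v ↦ Real.exp (b - v) * (ψ (Real.exp v) - Real.exp v) ^ 2)
        = fun v ↦ Real.exp b * (Real.exp (-v) * (ψ (Real.exp v) - Real.exp v) ^ 2) := by
      funext v; rw [sub_eq_add_neg, Real.exp_add]; ring
    rw [e, intervalIntegral.integral_const_mul]
    have h := hK (2 * b) (by linarith)
    have := mul_le_mul_of_nonneg_left h (Real.exp_pos b).le
    linarith
  constructor
  · have h := intervalIntegral.integral_comp_sub_left
      (fun v ↦ Real.exp (b - v) * (ψ (Real.exp v) - Real.exp v) ^ 2) b (a := -b) (b := b)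
    simp only [sub_sub_cancel, sub_neg_eq_add, sub_self] at h
    rw [show b + b = 2 * b by ring] at h
    rw [h]; exact hmain
  · have h := intervalIntegral.integral_comp_add_right
      (fun v ↦ Real.exp (b - v) * (ψ (Real.exp v) - Real.exp v) ^ 2) b (a := -b) (b := b)
    simp only [neg_add_cancel] at h
    rw [show b + b = 2 * b by ring] at h
    have e : (fun x ↦ Real.exp (-x) * (ψ (Real.exp (b + x)) - Real.exp (b + x)) ^ 2)
        = fun x ↦ Real.exp (b - (x + b)) * (ψ (Real.exp (x + b)) - Real.exp (x + b)) ^ 2 := by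
      funext x; rw [show b - (x + b) = -x by ring, add_comm x b]
    rw [e, h]; exact hmain

/-! ## §3 The sharp coupling of the cosh profile under RH -/

/-- **RH ⇒ THE COSH PROFILE IS AN APPROXIMATE EIGENVECTOR WITH COUPLING `O(b)` (Cramér)**: there is `K > 0` with, for every
`b ≥ 1`, the deviation `(T_bC_b)(x) − (e^b + 2b − 1)C_b(x)` square-integrable on `(−b, b)` and
`∫_{(−b,b)} ((T_bC_b)(x) − (e^b + 2b − 1)C_b(x))² dx ≤ K·(b + 1)·(b + sinh b)`. -/
theorem integral_primeShiftOp_coshProfile_sub_sharp_sq_le_of_RH (hRH : RiemannHypothesis) :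
    ∃ K : ℝ, 0 < K ∧ ∀ b : ℝ, 1 ≤ b →
      IntegrableOn (fun x ↦ (∑ n ∈ weilPrimeIndex b, (Λ n : ℝ) / Real.sqrt n *
          ((Icc (-b) b).indicator (fun y ↦ Real.cosh (y / 2)) (x - Real.log n)
            + (Icc (-b) b).indicator (fun y ↦ Real.cosh (y / 2)) (x + Real.log n))
          - (Real.exp b + 2 * b - 1) * (Icc (-b) b).indicator (fun y ↦ Real.cosh (y / 2)) x) ^ 2) (Ioo (-b) b) ∧
      ∫ x in Ioo (-b) b, (∑ n ∈ weilPrimeIndex b, (Λ n : ℝ) / Real.sqrt n *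
          ((Icc (-b) b).indicator (fun y ↦ Real.cosh (y / 2)) (x - Real.log n)
            + (Icc (-b) b).indicator (fun y ↦ Real.cosh (y / 2)) (x + Real.log n))
          - (Real.exp b + 2 * b - 1) * (Icc (-b) b).indicator (fun y ↦ Real.cosh (y / 2)) x) ^ 2
        ≤ K * (b + 1) * (b + Real.sinh b) := by
  obtain ⟨KC, hKC0, hKC⟩ := integral_exp_mul_sq_psi_sub_le_of_RH hRH
  refine ⟨4 * (51 + 3 * KC), by positivity, fun b hb ↦ ?_⟩
  have hb0 : 0 < b := by linarith
  have hbb : -b ≤ b := by linarith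
  set C := (Icc (-b) b).indicator (fun y ↦ Real.cosh (y / 2)) with hC
  obtain ⟨hCm, -, -⟩ := coshTest_admissible b
  -- the deviation and its majorant
  set D : ℝ → ℝ := fun x ↦ (∑ n ∈ weilPrimeIndex b, (Λ n : ℝ) / Real.sqrt n * (C (x - Real.log n) + C (x + Real.log n))
      - (Real.exp b + 2 * b - 1) * C x) ^ 2 with hD
  set E₂ : ℝ → ℝ := fun x ↦ ψ (Real.exp (b - x)) - Real.exp (b - x) with hE₂
  set E₃ : ℝ → ℝ := fun x ↦ ψ (Real.exp (b + x)) - Real.exp (b + x) with hE₃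
  set G : ℝ → ℝ := fun x ↦ 3 * ((Real.exp x * (x - b + 1) ^ 2 + Real.exp (-x) * (x + b - 1) ^ 2) / 2)
      + 3 * (Real.exp x / 2 * (16 + E₂ x ^ 2)) + 3 * (Real.exp (-x) / 2 * (E₃ x ^ 2 + 16)) with hG
  -- Mertens: `|H(y) − log y| ≤ 4`
  have hH : ∀ y : ℝ, 0 ≤ y → |(∑ n ∈ Finset.Ioc 0 ⌊Real.exp y⌋₊, (Λ n : ℝ) / n) - y| ≤ 4 := by
    intro y hy
    have h1 : 1 ≤ Real.exp y := by have := Real.add_one_le_exp y; linarith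
    have hlo := vonMangoldt_div_sum_ge h1
    have hhi := MertensFirstUpper.sum_vonMangoldt_div_floor_le_log_add h1
    rw [Real.log_exp] at hlo hhi
    rw [abs_le]; constructor <;> linarith
  -- pointwise: `D ≤ G` on `(−b, b)`
  have hDG : ∀ x ∈ Ioo (-b) b, D x ≤ G x := by
    intro x hx
    have hxm : x ∈ Icc (-b) b := ⟨hx.1.le, hx.2.le⟩
    have hdev : (∑ n ∈ weilPrimeIndex b, (Λ n : ℝ) / Real.sqrt n * (C (x - Real.log n) + C (x + Real.log n))
        - (Real.exp b + 2 * b - 1) * C x)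
        = (x * Real.sinh (x / 2) - (b - 1) * Real.cosh (x / 2))
          + Real.exp (x / 2) / 2 * (((∑ n ∈ Finset.Ioc 0 ⌊Real.exp (b + x)⌋₊, (Λ n : ℝ) / n) - (b + x)) + E₂ x)
          + Real.exp (-(x / 2)) / 2 * (E₃ x + ((∑ n ∈ Finset.Ioc 0 ⌊Real.exp (b - x)⌋₊, (Λ n : ℝ) / n) - (b - x))) := by
      have h := primeShiftOp_coshProfile_sub_eq (b := b) hx
      simp only [hC]
      have hCx : (Icc (-b) b).indicator (fun y ↦ Real.cosh (y / 2)) x = Real.cosh (x / 2) := indicator_of_mem hxm _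
      rw [show (Real.exp b + 2 * b - 1) = (Real.exp b + b) + (b - 1) by ring, add_mul, ← sub_sub, h, hCx, hE₂, hE₃]
      ring
    set E₁ := (∑ n ∈ Finset.Ioc 0 ⌊Real.exp (b + x)⌋₊, (Λ n : ℝ) / n) - (b + x) with hE₁
    set E₄ := (∑ n ∈ Finset.Ioc 0 ⌊Real.exp (b - x)⌋₊, (Λ n : ℝ) / n) - (b - x) with hE₄
    have h1 : |E₁| ≤ 4 := hE₁ ▸ hH (b + x) (by linarith [hx.1])
    have h4 : |E₄| ≤ 4 := hE₄ ▸ hH (b - x) (by linarith [hx.2])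
    have hE1sq : E₁ ^ 2 ≤ 16 := by have := abs_le.1 h1; nlinarith only [this.1, this.2]
    have hE4sq : E₄ ^ 2 ≤ 16 := by have := abs_le.1 h4; nlinarith only [this.1, this.2]
    have hex1 : Real.exp (x / 2) ^ 2 = Real.exp x := by rw [← Real.exp_nat_mul]; ring_nf
    have hex2 : Real.exp (-(x / 2)) ^ 2 = Real.exp (-x) := by rw [← Real.exp_nat_mul]; ring_nf
    have hsq1 : (Real.exp (x / 2) / 2 * (E₁ + E₂ x)) ^ 2 ≤ Real.exp x / 2 * (16 + E₂ x ^ 2) := by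
      rw [show (Real.exp (x / 2) / 2 * (E₁ + E₂ x)) ^ 2 = Real.exp (x / 2) ^ 2 / 4 * (E₁ + E₂ x) ^ 2 by ring, hex1]
      nlinarith only [mul_nonneg (Real.exp_pos x).le (sq_nonneg (E₁ - E₂ x)),
        mul_le_mul_of_nonneg_left hE1sq (Real.exp_pos x).le]
    have hsq2 : (Real.exp (-(x / 2)) / 2 * (E₃ x + E₄)) ^ 2 ≤ Real.exp (-x) / 2 * (E₃ x ^ 2 + 16) := by
      rw [show (Real.exp (-(x / 2)) / 2 * (E₃ x + E₄)) ^ 2 = Real.exp (-(x / 2)) ^ 2 / 4 * (E₃ x + E₄) ^ 2 by ring, hex2]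
      nlinarith only [mul_nonneg (Real.exp_pos (-x)).le (sq_nonneg (E₃ x - E₄)),
        mul_le_mul_of_nonneg_left hE4sq (Real.exp_pos (-x)).le]
    have h3sq : ∀ p₀ p₁ p₂ : ℝ, (p₀ + p₁ + p₂) ^ 2 ≤ 3 * (p₀ ^ 2 + p₁ ^ 2 + p₂ ^ 2) := fun p₀ p₁ p₂ ↦ by
      nlinarith only [sq_nonneg (p₀ - p₁), sq_nonneg (p₁ - p₂), sq_nonneg (p₀ - p₂)]
    simp only [hD, hG]
    rw [hdev]
    refine (h3sq _ _ _).trans ?_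
    have h0 := sq_recentred_le b x
    linarith only [h0, hsq1, hsq2]
  -- integrability
  have hDm : Measurable D := by
    refine (Measurable.sub (Finset.measurable_sum _ fun n _ ↦ ?_) (measurable_const.mul hCm)).pow_const 2
    exact measurable_const.mul ((hCm.comp (measurable_id.sub_const _)).add (hCm.comp (measurable_id.add_const _)))
  have hψm : Measurable ψ := Chebyshev.psi_mono.measurable
  have hE₂m : Measurable E₂ :=
    (hψm.comp (Real.measurable_exp.comp (measurable_const.sub measurable_id))).sub
      (Real.measurable_exp.comp (measurable_const.sub measurable_id))
  have hE₃m : Measurable E₃ :=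
    (hψm.comp (Real.measurable_exp.comp (measurable_const.add measurable_id))).sub
      (Real.measurable_exp.comp (measurable_const.add measurable_id))
  -- bounds for the prime-error pieces on `[−b, b]`: `|E| ≤ ψ(e^{2b}) + e^{2b}`
  have hEb : ∀ y : ℝ, y ≤ 2 * b → |ψ (Real.exp y) - Real.exp y| ≤ ψ (Real.exp (2 * b)) + Real.exp (2 * b) := by
    intro y hy
    have h1 := Chebyshev.psi_mono (Real.exp_le_exp.2 hy)
    have h2 := Chebyshev.psi_nonneg (Real.exp y)
    have h3 := Real.exp_le_exp.2 hy
    have h4 := Real.exp_pos y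
    rw [abs_le]; constructor <;> linarith
  set B := ψ (Real.exp (2 * b)) + Real.exp (2 * b) with hB
  have hB0 : 0 ≤ B := by have := Chebyshev.psi_nonneg (Real.exp (2 * b)); positivity
  have hf₂ : IntervalIntegrable (fun x ↦ Real.exp x * (ψ (Real.exp (b - x)) - Real.exp (b - x)) ^ 2) volume (-b) b := by
    refine intervalIntegrable_of_abs_le hbb (Real.measurable_exp.mul (hE₂m.pow_const 2)) (M := Real.exp b * B ^ 2)
      fun x hx ↦ ?_
    rw [abs_of_nonneg (by positivity)]
    have h1 : Real.exp x ≤ Real.exp b := Real.exp_le_exp.2 hx.2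
    have h2 : (ψ (Real.exp (b - x)) - Real.exp (b - x)) ^ 2 ≤ B ^ 2 := by
      have := hEb (b - x) (by linarith [hx.1])
      rw [← sq_abs]; exact pow_le_pow_left₀ (abs_nonneg _) this 2
    exact mul_le_mul h1 h2 (sq_nonneg _) (Real.exp_pos b).le
  have hf₃ : IntervalIntegrable (fun x ↦ Real.exp (-x) * (ψ (Real.exp (b + x)) - Real.exp (b + x)) ^ 2) volume (-b) b := by
    refine intervalIntegrable_of_abs_le hbb (Real.measurable_exp.comp measurable_neg |>.mul (hE₃m.pow_const 2))
      (M := Real.exp b * B ^ 2) fun x hx ↦ ?_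
    rw [abs_of_nonneg (by positivity)]
    have h1 : Real.exp (-x) ≤ Real.exp b := Real.exp_le_exp.2 (by linarith [hx.1])
    have h2 : (ψ (Real.exp (b + x)) - Real.exp (b + x)) ^ 2 ≤ B ^ 2 := by
      have := hEb (b + x) (by linarith [hx.2])
      rw [← sq_abs]; exact pow_le_pow_left₀ (abs_nonneg _) this 2
    exact mul_le_mul h1 h2 (sq_nonneg _) (Real.exp_pos b).le
  have hGi : IntervalIntegrable G volume (-b) b := by
    have h1 : IntervalIntegrable (fun x ↦ 3 * ((Real.exp x * (x - b + 1) ^ 2 + Real.exp (-x) * (x + b - 1) ^ 2) / 2))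
        volume (-b) b := (by fun_prop : Continuous fun x ↦
          3 * ((Real.exp x * (x - b + 1) ^ 2 + Real.exp (-x) * (x + b - 1) ^ 2) / 2)).intervalIntegrable _ _
    have h2 : IntervalIntegrable (fun x ↦ 3 * (Real.exp x / 2 * (16 + E₂ x ^ 2))) volume (-b) b := by
      have e : (fun x ↦ 3 * (Real.exp x / 2 * (16 + E₂ x ^ 2)))
          = fun x ↦ 24 * Real.exp x + 3 / 2 * (Real.exp x * (ψ (Real.exp (b - x)) - Real.exp (b - x)) ^ 2) := by
        funext x; simp only [hE₂]; ring
      rw [e]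
      exact ((Real.continuous_exp.intervalIntegrable _ _).const_mul _).add (hf₂.const_mul _)
    have h3 : IntervalIntegrable (fun x ↦ 3 * (Real.exp (-x) / 2 * (E₃ x ^ 2 + 16))) volume (-b) b := by
      have e : (fun x ↦ 3 * (Real.exp (-x) / 2 * (E₃ x ^ 2 + 16)))
          = fun x ↦ 3 / 2 * (Real.exp (-x) * (ψ (Real.exp (b + x)) - Real.exp (b + x)) ^ 2) + 24 * Real.exp (-x) := by
        funext x; simp only [hE₃]; ring
      rw [e]
      exact (hf₃.const_mul _).add (((Real.continuous_exp.comp continuous_neg).intervalIntegrable _ _).const_mul _)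
    exact (h1.add h2).add h3
  -- `D` is integrable on `(−b, b)`: dominated by `G`
  have hGint : IntegrableOn G (Ioo (-b) b) := by
    have := (intervalIntegrable_iff_integrableOn_Ioo_of_le hbb).1 hGi
    exact this
  have hDint : IntegrableOn D (Ioo (-b) b) := by
    refine Integrable.mono' hGint hDm.aestronglyMeasurable.restrict ?_
    refine (ae_restrict_mem measurableSet_Ioo).mono fun x hx ↦ ?_
    rw [Real.norm_eq_abs, abs_of_nonneg (by simp only [hD]; positivity)]
    exact hDG x hx
  refine ⟨hDint, ?_⟩
  -- integrate the majorant
  have hIG : ∫ x in Ioo (-b) b, G x = ∫ x in (-b)..b, G x := by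
    rw [intervalIntegral.integral_of_le hbb, integral_Ioc_eq_integral_Ioo]
  obtain ⟨he1, he2⟩ := integral_exp_le_and b
  have hp := integral_exp_mul_sq_sub_le b
  have hq := integral_exp_neg_mul_sq_add_le b
  obtain ⟨hc2, hc3⟩ := hKC b hb0.le
  have hGval : ∫ x in (-b)..b, G x
      = 3 / 2 * ((∫ x in (-b)..b, Real.exp x * (x - b + 1) ^ 2) + ∫ x in (-b)..b, Real.exp (-x) * (x + b - 1) ^ 2)
        + (24 * (∫ x in (-b)..b, Real.exp x)
          + 3 / 2 * ∫ x in (-b)..b, Real.exp x * (ψ (Real.exp (b - x)) - Real.exp (b - x)) ^ 2)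
        + (3 / 2 * (∫ x in (-b)..b, Real.exp (-x) * (ψ (Real.exp (b + x)) - Real.exp (b + x)) ^ 2)
          + 24 * ∫ x in (-b)..b, Real.exp (-x)) := by
    have i1 : IntervalIntegrable (fun x ↦ Real.exp x * (x - b + 1) ^ 2) volume (-b) b :=
      (by fun_prop : Continuous fun x ↦ Real.exp x * (x - b + 1) ^ 2).intervalIntegrable _ _
    have i2 : IntervalIntegrable (fun x ↦ Real.exp (-x) * (x + b - 1) ^ 2) volume (-b) b :=
      (by fun_prop : Continuous fun x ↦ Real.exp (-x) * (x + b - 1) ^ 2).intervalIntegrable _ _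
    have i3 : IntervalIntegrable (fun x ↦ Real.exp x) volume (-b) b := Real.continuous_exp.intervalIntegrable _ _
    have i4 : IntervalIntegrable (fun x ↦ Real.exp (-x)) volume (-b) b :=
      (Real.continuous_exp.comp continuous_neg).intervalIntegrable _ _
    have e : G = fun x ↦ (3 / 2 * (Real.exp x * (x - b + 1) ^ 2) + 3 / 2 * (Real.exp (-x) * (x + b - 1) ^ 2))
        + ((24 * Real.exp x + 3 / 2 * (Real.exp x * (ψ (Real.exp (b - x)) - Real.exp (b - x)) ^ 2))
        + (3 / 2 * (Real.exp (-x) * (ψ (Real.exp (b + x)) - Real.exp (b + x)) ^ 2) + 24 * Real.exp (-x))) := by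
      funext x; simp only [hG, hE₂, hE₃]; ring
    rw [e, intervalIntegral.integral_add ((i1.const_mul _).add (i2.const_mul _))
        (((i3.const_mul _).add (hf₂.const_mul _)).add ((hf₃.const_mul _).add (i4.const_mul _))),
      intervalIntegral.integral_add (i1.const_mul _) (i2.const_mul _),
      intervalIntegral.integral_add ((i3.const_mul _).add (hf₂.const_mul _)) ((hf₃.const_mul _).add (i4.const_mul _)),
      intervalIntegral.integral_add (i3.const_mul _) (hf₂.const_mul _),
      intervalIntegral.integral_add (hf₃.const_mul _) (i4.const_mul _)]
    simp only [intervalIntegral.integral_const_mul]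
    ring
  have hexp2 : Real.exp b ≤ 2 * (b + Real.sinh b) := by
    rw [Real.sinh_eq]
    have : Real.exp (-b) ≤ 1 := Real.exp_le_one_iff.2 (by linarith)
    linarith
  calc ∫ x in Ioo (-b) b, D x ≤ ∫ x in Ioo (-b) b, G x :=
        setIntegral_mono_on hDint hGint measurableSet_Ioo hDG
    _ = ∫ x in (-b)..b, G x := hIG
    _ ≤ 3 / 2 * (Real.exp b + Real.exp b) + (24 * Real.exp b + 3 / 2 * (KC * (2 * b + 1) * Real.exp b))
        + (3 / 2 * (KC * (2 * b + 1) * Real.exp b) + 24 * Real.exp b) := by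
        rw [hGval]; gcongr
    _ = (51 + 3 * KC * (2 * b + 1)) * Real.exp b := by ring
    _ ≤ ((51 + 3 * KC) * (2 * b + 1)) * Real.exp b := by
        refine mul_le_mul_of_nonneg_right ?_ (Real.exp_pos b).le
        nlinarith only [hKC0, hb]
    _ ≤ ((51 + 3 * KC) * (2 * b + 1)) * (2 * (b + Real.sinh b)) :=
        mul_le_mul_of_nonneg_left hexp2 (by positivity)
    _ ≤ 4 * (51 + 3 * KC) * (b + 1) * (b + Real.sinh b) := by
        have hP : 0 ≤ b + Real.sinh b := by have := Real.sinh_pos_iff.2 hb0; linarith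
        nlinarith only [hP, hKC0, hb]

end FloorCoshSplit

end Summit.RiemannHypothesis.RiemannHypothesis.Theorems.WeilFormatC
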